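import Summits.Ventures.PercRepro.RankLevelSetTriangleStar

/-!
# PercRepro — the nullity lemma for triangle lists (p3 g20; S1 §6.3 (v), proofs/P3-TRIANGLE-CAP.md §2)

Adding `3`-circuits («triangles») one at a time, every triangle that brings a point not yet covered raises the
nullity of the union by at least one: if the new points are `c` (one), the others `y, z` are old and
`c ∈ cl {y, z}`, so the rank does not change; with two or three new points the rank rises by at most one or two.
Hence, for a list `L` of triangles, `r(⋃ L) + newCount L ≤ |⋃ L|`, where `newCount L` is the number of
positions whose triangle has a point outside the union of the triangles that precede it (the list is read from
its tail: `L = [t_m, …, t₁]`, `t₁` first).  This is the kernel half of the triangle cap: the hypergraph relaxation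
`s₃ ≤ P(ν)` of the paper note rests on it and on the flat-size facts of the Core.

* `unionL L` — the union of the members of `L`;
* `newCount L` — the number of members with a point outside the union of the later (= earlier-added) members;
* **`eRk_add_newCount_le_ncard`** — `r(⋃ L) + newCount L ≤ |⋃ L|` for a list of `3`-circuits;
* `newCount_le_nullity` — `newCount L ≤ |E| − r(E)` when `|E| = r(E) + d`, for any list of triangles of `M`.
Axioms: standard.
-/

namespace PercRepro

namespace TriangleCap

open Set

variable {α : Type}

/-- The union of the members of a list of sets. -/
def unionL : List (Set α) → Set α
  | [] => ∅
  | C :: L => C ∪ unionL L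

open Classical in
/-- The number of positions of `L` whose set has a point outside the union of the members after it in the list
(the members after it are the ones added before it in the growth order). -/
noncomputable def newCount : List (Set α) → ℕ
  | [] => 0
  | C :: L => newCount L + (if C ⊆ unionL L then 0 else 1)

/-- `unionL` of the empty list. -/
@[simp] theorem unionL_nil : unionL ([] : List (Set α)) = ∅ := rfl

/-- `unionL` of a cons. -/
@[simp] theorem unionL_cons (C : Set α) (L : List (Set α)) : unionL (C :: L) = C ∪ unionL L := rfl

/-- `newCount` of the empty list. -/
@[simp] theorem newCount_nil : newCount ([] : List (Set α)) = 0 := rfl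

open Classical in
/-- `newCount` of a cons: the tail's count plus one when the head has a point outside the tail's union. -/
theorem newCount_cons (C : Set α) (L : List (Set α)) :
    newCount (C :: L) = newCount L + (if C ⊆ unionL L then 0 else 1) := rfl

/-- The union of a list of subsets of the ground set lies in the ground set. -/
theorem unionL_subset_ground (M : Matroid α) (L : List (Set α)) (hL : ∀ C ∈ L, C ⊆ M.E) :
    unionL L ⊆ M.E := by
  induction L with
  | nil => simp
  | cons C L ih =>
    rw [unionL_cons]
    exact union_subset (hL C (List.mem_cons_self ..)) (ih fun D hD => hL D (List.mem_cons_of_mem _ hD))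

/-- **The nullity lemma.** For a list `L` of `3`-circuits of a finite matroid,
`r(⋃ L) + newCount L ≤ |⋃ L|`. -/
theorem eRk_add_newCount_le_ncard (M : Matroid α) [M.Finite] (L : List (Set α))
    (hL : ∀ C ∈ L, M.IsCircuit C ∧ C.ncard = 3) :
    M.eRk (unionL L) + newCount L ≤ ((unionL L).ncard : ℕ∞) := by
  induction L with
  | nil => simp
  | cons C L ih =>
    have hC := hL C (List.mem_cons_self ..)
    have ih' := ih fun D hD => hL D (List.mem_cons_of_mem _ hD)
    have hUE : unionL L ⊆ M.E :=
      unionL_subset_ground M L fun D hD => (hL D (List.mem_cons_of_mem _ hD)).1.subset_ground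
    have hUfin : (unionL L).Finite := M.ground_finite.subset hUE
    have hCfin : C.Finite := M.ground_finite.subset hC.1.subset_ground
    rw [unionL_cons, newCount_cons]
    by_cases hsub : C ⊆ unionL L
    · rw [if_pos hsub, union_eq_self_of_subset_left hsub]
      simpa using ih'
    · rw [if_neg hsub]
      obtain ⟨x, hxC, hxU⟩ : ∃ x ∈ C, x ∉ unionL L := not_subset.1 hsub
      -- the rank of `C ∪ U` is the rank of `(C \ {x}) ∪ U`, as `x ∈ cl (C \ {x})`
      have hcl : M.closure (C \ {x}) = M.closure C :=
        Matroid.closure_sdiff_singleton_eq_closure (hC.1.mem_closure_sdiff_singleton_of_mem hxC)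
      have hrk : M.eRk (C ∪ unionL L) = M.eRk ((C \ {x}) ∪ unionL L) := by
        rw [← M.eRk_closure_eq, ← M.eRk_closure_eq ((C \ {x}) ∪ _),
          Matroid.closure_union_congr_left hcl]
      -- `(C \ {x}) ∪ U = U ∪ ((C \ {x}) \ U)` and the rank of that is at most `r(U) + |(C \ {x}) \ U|`
      have hrk2 : M.eRk ((C \ {x}) ∪ unionL L) ≤ M.eRk (unionL L) + ((C \ {x}) \ unionL L).encard := by
        rw [union_comm, ← union_sdiff_self]
        exact M.eRk_union_le_eRk_add_encard _ _
      -- the counts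
      have hDfin : ((C \ {x}) \ unionL L).Finite := hCfin.subset (fun y hy => hy.1.1)
      have hcnt : (C ∪ unionL L).ncard = (unionL L).ncard + (((C \ {x}) \ unionL L).ncard + 1) := by
        rw [union_comm, ← union_sdiff_self, ncard_union_eq disjoint_sdiff_right hUfin (hCfin.subset sdiff_subset)]
        congr 1
        have hx' : x ∈ C \ unionL L := ⟨hxC, hxU⟩
        rw [← ncard_sdiff_singleton_add_one hx' (hCfin.subset sdiff_subset)]
        congr 2
        ext y
        simp only [mem_sdiff, mem_singleton_iff]
        tauto
      rw [hrk, hcnt]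
      have hDcast : (((C \ {x}) \ unionL L).ncard : ℕ∞) = ((C \ {x}) \ unionL L).encard :=
        hDfin.cast_ncard_eq
      calc M.eRk ((C \ {x}) ∪ unionL L) + (newCount L + 1 : ℕ)
          ≤ (M.eRk (unionL L) + ((C \ {x}) \ unionL L).encard) + (newCount L + 1 : ℕ) := by
            gcongr
        _ = (M.eRk (unionL L) + newCount L) + (((C \ {x}) \ unionL L).encard + 1) := by
            push_cast; ring
        _ ≤ ((unionL L).ncard : ℕ∞) + (((C \ {x}) \ unionL L).encard + 1) := by
            gcongr
        _ = (((unionL L).ncard + (((C \ {x}) \ unionL L).ncard + 1) : ℕ) : ℕ∞) := by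
            rw [← hDcast]; push_cast; ring

/-- The growth count of any list of triangles of `M` is at most the nullity `d` of `M` (`|E| = r(E) + d`). -/
theorem newCount_le_nullity (M : Matroid α) [M.Finite] (L : List (Set α))
    (hL : ∀ C ∈ L, C ∈ ThmN.triangles M) {d : ℕ} (hd : M.E.encard = M.eRank + d) :
    newCount L ≤ d := by
  have hL' : ∀ C ∈ L, M.IsCircuit C ∧ C.ncard = 3 := fun C hC => hL C hC
  have h := eRk_add_newCount_le_ncard M L hL'
  have hUE : unionL L ⊆ M.E := unionL_subset_ground M L fun C hC => (hL' C hC).1.subset_ground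
  -- `|U| − r(U) ≤ |E| − r(E) = d`: `r(E) ≤ r(U) + |E \ U|` (submodularity) and `|E| = |U| + |E \ U|`
  have hUfin : (unionL L).Finite := M.ground_finite.subset hUE
  have hDfin : (M.E \ unionL L).Finite := M.ground_finite.subset sdiff_subset
  have h1 : M.eRank ≤ M.eRk (unionL L) + (M.E \ unionL L).encard := by
    calc M.eRank = M.eRk (unionL L ∪ (M.E \ unionL L)) := by rw [M.eRank_def, union_sdiff_cancel hUE]
      _ ≤ _ := M.eRk_union_le_eRk_add_encard _ _
  have hcard : M.E.encard = (unionL L).encard + (M.E \ unionL L).encard := by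
    rw [← encard_union_eq disjoint_sdiff_right, union_sdiff_cancel hUE]
  -- everything is finite: pass to `ℕ`
  have hrne : M.eRk (unionL L) ≠ ⊤ :=
    ((M.eRk_le_encard _).trans_lt hUfin.encard_lt_top).ne
  obtain ⟨r, hr⟩ := ENat.ne_top_iff_exists.1 hrne
  have hRne : M.eRank ≠ ⊤ :=
    ((M.eRank_le_encard_ground).trans_lt M.ground_finite.encard_lt_top).ne
  obtain ⟨R, hR⟩ := ENat.ne_top_iff_exists.1 hRne
  rw [← hr] at h h1
  rw [← hR] at h1 hd
  rw [← hUfin.cast_ncard_eq, ← hDfin.cast_ncard_eq] at hcard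
  rw [← hDfin.cast_ncard_eq] at h1
  rw [hcard] at hd
  have h' : r + newCount L ≤ (unionL L).ncard := by exact_mod_cast h
  have h1' : R ≤ r + (M.E \ unionL L).ncard := by exact_mod_cast h1
  have hd' : (unionL L).ncard + (M.E \ unionL L).ncard = R + d := by exact_mod_cast hd
  omega

end TriangleCap

end PercRepro
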